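import Literature.MathematicalPhysics.QuantumManyBody.NeumannBoseGasCondensation
import HarnessLib

/-!
# Weak condensation of the dilute Bose gas on LARGE Neumann boxes (Junge 2026, Corollary 6 at `T = 0`)

Topic `Literature/MathematicalPhysics/QuantumManyBody`, namespace `…BoseGas`. Companion of
`NeumannBoseGasCondensation.lean`, which vendors Junge's Theorem 4 at zero temperature on the box of
side EXACTLY `L = a(ρa³)^{−1/2−η}` (`Junge2026_neumannBox_pinnedLowerBound`) and lists Corollary 6 —
the same pinned bound propagated to boxes `R ≥ L` by the Neumann localisation (Thm. 3) — under
"Not vendored". This file vendors exactly that corollary, at `T = 0`, in the same additive `ℝ≥0∞`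
shape, and PROVES from it the weak condensation estimate for near-minimisers (the `T = 0` reading of
eq. (26)). Wanted by the box line of `AtomisticToContinuum/BoseEinsteinCondensation`
(route `bec-lattice-fsum`, declared residual `BoxDeepInfraredEmptiness`, node «HorizonTransfer»,
piece `HorizonLocalDepletion`: depletion of a near-minimiser relative to the constant mode of a
SUPERBLOCK of side `R = mℓ ≥ a(ρa³)^{−1/2−η}`, where `ρR²a = A²m²a` in the window `ℓ = A/√ρ`).

Carriers (all real definitions of the tree, units `ħ = 2m = 1`): `NeumannTrialState N R`,
`neumannEnergy v Ψ` (`LiebYngvasonLowerBound.lean`), `scatteringLength v`,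
`condensateOccupation N R Ψ = ⟨Ψ, n₀Ψ⟩` in the constant mode of `[0,R)³` (`PeriodicBoseGas.lean`),
`IsRepulsiveFiniteRange`, `Config`.

## Source and what is vendored

L. Junge, *Propagation of condensation via Neumann localization in the dilute Bose gas*,
arXiv:2603.20776v3 (2026), §"Application to the dilute Bose gas", pp. 5–7 (read: p. 6 Corollary 6,
Remark 7, proof pp. 6–7). **Corollary 6**: "Let `v, T, η` and `C` be given as in Theorem 4. Then for
`R ≥ a(ρa³)^{−1/2−η}` we have `Tr(n₊e^{−βH_N})/Tr(e^{−βH_N}) ≤ C N ρR²a(ρa³)^{1/2+η}` (26) with `H_N`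
given as in eq. (19) defined on `L²([0,R]^{3N})` satisfying `N = ρR³`." Its proof (p. 6 eq. (27) –
p. 7) establishes, for a pinning coefficient `ε` with `εC₃ ≤ η` (`C₃` the constant of the Neumann
localisation Thm. 3), the operator lower bound `H_N − ε n₊/R² ≥ (average of localised Hamiltonians)`
and from Theorem 4 on the local boxes, superadditivity, convexity in the particle numbers and the
positivity of the interaction, the last display of p. 7:
`−T log Tr e^{−β(H_N − ε n₊/R²)} ≥ 4πρaN(1 + (128/(15√π))√(ρa³) − C(ρa³)^{1/2+η}) + R³T^{5/2}(2π)^{−3}∫log(1−e^{−√(p⁴+16πp²ρa/T)})dp`,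
"combining this lower bound with the corresponding upper bound [9] and the variational principle
yields the desired result".

As in the companion file, the tree has no Gibbs states, traces or temperature, so we vendor the
**zero-temperature content**: at `T = 0` the free energy of `H_N − ε n₊/R²` is the bottom of its
spectrum = the infimum of its quadratic form over normalised Bose-symmetric states in the Neumann
form domain, and the thermal integral vanishes. NAMED FACT `Junge2026_neumannLargeBox_pinnedLowerBound`
(D-0014): there are `C, η, ε, c > 0` (depending on `v`) such that for all `N ≥ 1`, `R > 0` with
`ρ := N/R³`, `ρa³ ≤ c` and `R ≥ a(ρa³)^{−1/2−η}`, every normalised Bose-symmetric `Ψ ∈ H¹(Λ_R^N)`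
satisfies `⟨Ψ, H_NΨ⟩ − (ε/R²)⟨Ψ, n₊Ψ⟩ ≥ 4πρaN(1 + (128/(15√π))√(ρa³) − C(ρa³)^{1/2+η})`, written
additively with `⟨Ψ, n₊Ψ⟩ = N − ⟨Ψ, n₀Ψ⟩`. From it we PROVE
`Junge2026_neumannLargeBox_pinnedLowerBound.condensation`: a near-minimiser
(`⟨Ψ,HΨ⟩ ≤ 4πρaN(1 + (128/(15√π))√(ρa³)) + C₀ρaN(ρa³)^{1/2+η}`) has
`N ≤ ⟨Ψ, n₀Ψ⟩ + C'ρaR²(ρa³)^{1/2+η}N`, `C' = (4πC + C₀)/ε` — the `T = 0` form of (26).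

SOURCE STATUS (as for Theorem 4 in the companion file): the corollary rests on Junge's Thm. 4, his
pinned restatement of Fournais–Junge–Girardot–Morin–Olivieri–Triay, arXiv:2408.14222 = Ann. Henri
Poincaré (2026) Thm. 1.3 (`v ≥ 0` radially decreasing, compactly supported; `0 < η < 1/1026`;
support radius `≤ C₀a`); the dilute-regime restriction `ρa³ ≤ c` is implicit in "as in Theorem 4";
hard cores: FJGMOT allow "strong potentials" incl. hard core — recorded, not relied on beyond
`IsRepulsiveFiniteRange` + `AntitoneOn` exactly as the companion fact does. Preprint (v3, 4 Apr 2026),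
not yet refereed: `status: under-review`.

## Not vendored

Positive temperature; the Neumann localisation inequality Thm. 1 / Thm. 3 itself (discrete Neumann
Laplacian on the lattice of boxes — a separate, purely kinetic fact, worth its own file if a route
wants it); Remark 7's `κ`-parametrisation.

## References

* [Junge2026] L. Junge, arXiv:2603.20776v3, Thm. 3, Thm. 4, Cor. 6 eq. (26), proof eq. (27)–(28).
* [FournaisEtAl2024] S. Fournais, L. Junge, T. Girardot, L. Morin, M. Olivieri, A. Triay,
  arXiv:2408.14222, Ann. Henri Poincaré (2026), Thm. 1.3.
-/

noncomputable section

open scoped ENNReal NNReal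
open MeasureTheory

namespace Literature.MathematicalPhysics.QuantumManyBody.BoseGas

/-- **Junge 2026, Corollary 6 at zero temperature (large Neumann box, pinned lower bound).** Let the
pair potential profile `v ≥ 0` be radially non-increasing and of finite range, with scattering length
`0 < a < ∞`. Then there are `C, η, ε, c > 0` such that for all `N ≥ 1`, `R > 0` with `ρ := N/R³`,
`ρa³ ≤ c` and `R ≥ a(ρa³)^{−1/2−η}`, every normalised BOSE-SYMMETRIC Neumann state `Ψ` on `Λ_R^N`
satisfies `⟨Ψ, H_N Ψ⟩ − (ε/R²)⟨Ψ, n₊Ψ⟩ ≥ 4πρaN(1 + (128/(15√π))√(ρa³) − C(ρa³)^{1/2+η})`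
(printed for the free energy of `H_N − ε n₊/R²`, last display of the proof of Cor. 6, p. 7; at `T = 0`
the free energy is the infimum of the quadratic form and the thermal term vanishes). Written
additively in `ℝ≥0∞` with `⟨Ψ, n₊Ψ⟩ = N − ⟨Ψ, n₀Ψ⟩`, `⟨Ψ, n₀Ψ⟩ = condensateOccupation N R Ψ`.
The case `R = a(ρa³)^{−1/2−η}` is `Junge2026_neumannBox_pinnedLowerBound` (with `ε = η`).
Locator: Junge 2026, Cor. 6 and its proof, eq. (27) – last display p. 7, at `T = 0`.
[claim: Junge2026, status: under-review] -/
def Junge2026_neumannLargeBox_pinnedLowerBound : Prop :=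
  ∀ (v : ℝ → ℝ≥0∞), IsRepulsiveFiniteRange v → AntitoneOn v (Set.Ici 0) →
    scatteringLength v ≠ ⊤ → 0 < scatteringLength v →
  ∃ C η ε c : ℝ, 0 < C ∧ 0 < η ∧ 0 < ε ∧ 0 < c ∧
    ∀ (N : ℕ) (R : ℝ), 0 < N → 0 < R →
      let a := (scatteringLength v).toReal
      let ρ := (N : ℝ) / R ^ 3
      ρ * a ^ 3 ≤ c →
      a * (ρ * a ^ 3) ^ (-(1 / 2 + η)) ≤ R →
      ∀ Ψ : NeumannTrialState N R,
        (∀ (σ : Equiv.Perm (Fin N)) (X : Config N), Ψ.ψ (X ∘ σ) = Ψ.ψ X) →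
        ENNReal.ofReal (4 * Real.pi * ρ * a * N *
              (1 + 128 / (15 * Real.sqrt Real.pi) * Real.sqrt (ρ * a ^ 3)
                - C * (ρ * a ^ 3) ^ (1 / 2 + η)))
            + ENNReal.ofReal (ε / R ^ 2) * (N : ℝ≥0∞)
          ≤ neumannEnergy v Ψ + ENNReal.ofReal (ε / R ^ 2) * condensateOccupation N R Ψ.ψ

namespace Junge2026_neumannLargeBox_pinnedLowerBound

/-- **Weak condensation of near-minimisers on large Neumann boxes** (zero-temperature analogue of
Junge's eq. (26), PROVED from the pinned lower bound): with `C, η, ε, c` from the named fact and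
`C' = (4πC + C₀)/ε`, every normalised Bose-symmetric Neumann state on a box `R ≥ a(ρa³)^{−1/2−η}`,
`ρa³ ≤ c`, with `⟨Ψ, H_N Ψ⟩ ≤ 4πρaN(1 + (128/(15√π))√(ρa³)) + C₀ ρaN(ρa³)^{1/2+η}` has
`N ≤ ⟨Ψ, n₀Ψ⟩ + C' ρ a R² (ρa³)^{1/2+η} N`, i.e. `⟨Ψ, n₊Ψ⟩ ≤ C' N ρR²a (ρa³)^{1/2+η}`.
Locator: Junge 2026, Cor. 6 eq. (26), at `T = 0`. [claim: Junge2026, status: under-review] -/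
theorem condensation (h : Junge2026_neumannLargeBox_pinnedLowerBound) :
    ∀ (v : ℝ → ℝ≥0∞), IsRepulsiveFiniteRange v → AntitoneOn v (Set.Ici 0) →
      scatteringLength v ≠ ⊤ → 0 < scatteringLength v →
    ∀ C₀ : ℝ, 0 ≤ C₀ →
    ∃ C η c : ℝ, 0 < C ∧ 0 < η ∧ 0 < c ∧
      ∀ (N : ℕ) (R : ℝ), 0 < N → 0 < R →
        let a := (scatteringLength v).toReal
        let ρ := (N : ℝ) / R ^ 3
        ρ * a ^ 3 ≤ c →
        a * (ρ * a ^ 3) ^ (-(1 / 2 + η)) ≤ R →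
        ∀ Ψ : NeumannTrialState N R,
          (∀ (σ : Equiv.Perm (Fin N)) (X : Config N), Ψ.ψ (X ∘ σ) = Ψ.ψ X) →
          neumannEnergy v Ψ ≤ ENNReal.ofReal (4 * Real.pi * ρ * a * N *
                (1 + 128 / (15 * Real.sqrt Real.pi) * Real.sqrt (ρ * a ^ 3))
              + C₀ * ρ * a * N * (ρ * a ^ 3) ^ (1 / 2 + η)) →
          (N : ℝ≥0∞) ≤ condensateOccupation N R Ψ.ψ +
              ENNReal.ofReal (C * ρ * a * R ^ 2 * (ρ * a ^ 3) ^ (1 / 2 + η) * N) := by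
  intro v hv hmono hatop hapos C₀ hC₀
  obtain ⟨C, η, ε, c, hC, hη, hε, hc, hmain⟩ := h v hv hmono hatop hapos
  refine ⟨(4 * Real.pi * C + C₀) / ε, η, c, by positivity, hη, hc, ?_⟩
  intro N R hN hR a ρ hdil hbox Ψ hsymm hE
  have hpin := hmain N R hN hR hdil hbox Ψ hsymm
  set t : ℝ := (ρ * a ^ 3) ^ (1 / 2 + η) with ht
  set R₀ : ℝ := 4 * Real.pi * ρ * a * N *
      (1 + 128 / (15 * Real.sqrt Real.pi) * Real.sqrt (ρ * a ^ 3) - C * t) with hRdef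
  set S : ℝ := 4 * Real.pi * ρ * a * N * C * t + C₀ * ρ * a * N * t with hSdef
  have hk0 : ENNReal.ofReal (ε / R ^ 2) ≠ 0 := by
    rw [ne_eq, ENNReal.ofReal_eq_zero, not_le]; positivity
  have hsplit : (4 * Real.pi * ρ * a * N *
        (1 + 128 / (15 * Real.sqrt Real.pi) * Real.sqrt (ρ * a ^ 3)) + C₀ * ρ * a * N * t) =
      R₀ + S := by
    rw [hRdef, hSdef]; ring
  have hE' : neumannEnergy v Ψ ≤ ENNReal.ofReal R₀ + ENNReal.ofReal S := by
    refine hE.trans ?_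
    rw [hsplit]
    exact ENNReal.ofReal_add_le
  have hcore := Junge2026_neumannBox_pinnedLowerBound.le_add_inv_mul_of_pinned
    ENNReal.ofReal_ne_top hk0 ENNReal.ofReal_ne_top hpin hE'
  refine hcore.trans (le_of_eq ?_)
  congr 1
  rw [← ENNReal.ofReal_inv_of_pos (by positivity), ← ENNReal.ofReal_mul (by positivity)]
  congr 1
  rw [hSdef]
  field_simp

/-- The companion fact on the box of side exactly `L = a(ρa³)^{−1/2−η}` is the special case `R = L`
(with `ε = η`). Locator: Junge 2026, Cor. 6 at `R = L` (the shape of Thm. 4), `T = 0`.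
[claim: Junge2026, status: under-review] -/
theorem box_of_largeBox (h : Junge2026_neumannLargeBox_pinnedLowerBound) :
    ∀ (v : ℝ → ℝ≥0∞), IsRepulsiveFiniteRange v → AntitoneOn v (Set.Ici 0) →
      scatteringLength v ≠ ⊤ → 0 < scatteringLength v →
    ∃ C η ε c : ℝ, 0 < C ∧ 0 < η ∧ 0 < ε ∧ 0 < c ∧
      ∀ (N : ℕ) (L : ℝ), 0 < N → 0 < L →
        let a := (scatteringLength v).toReal
        let ρ := (N : ℝ) / L ^ 3
        ρ * a ^ 3 ≤ c →
        L = a * (ρ * a ^ 3) ^ (-(1 / 2 + η)) →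
        ∀ Ψ : NeumannTrialState N L,
          (∀ (σ : Equiv.Perm (Fin N)) (X : Config N), Ψ.ψ (X ∘ σ) = Ψ.ψ X) →
          ENNReal.ofReal (4 * Real.pi * ρ * a * N *
                (1 + 128 / (15 * Real.sqrt Real.pi) * Real.sqrt (ρ * a ^ 3)
                  - C * (ρ * a ^ 3) ^ (1 / 2 + η)))
              + ENNReal.ofReal (ε / L ^ 2) * (N : ℝ≥0∞)
            ≤ neumannEnergy v Ψ + ENNReal.ofReal (ε / L ^ 2) * condensateOccupation N L Ψ.ψ := by
  intro v hv hmono hatop hapos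
  obtain ⟨C, η, ε, c, hC, hη, hε, hc, hmain⟩ := h v hv hmono hatop hapos
  refine ⟨C, η, ε, c, hC, hη, hε, hc, ?_⟩
  intro N L hN hL a ρ hdil hbox Ψ hsymm
  exact hmain N L hN hL hdil (le_of_eq hbox.symm) Ψ hsymm

end Junge2026_neumannLargeBox_pinnedLowerBound

end Literature.MathematicalPhysics.QuantumManyBody.BoseGas

end
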